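import Summits.Ventures.HodgeRepro.CosetQuadCore

/-!
# The twisted rectangle for a general `⟨v⟩` (`ℤ/m ⋊ ℤ/2`), and route-2's Theorem T (i) at `k = 6` (degree 24)

Blind re-derivation cell `pub-hodge-repro`, seat `p1` (gen 12).  `TwistedQuad16.lean` treated the degree-16 groups
`ℤ/8 ⋊ ℤ/2`; this file repeats the construction for an arbitrary modulus `m` (`v` of order `m`, `c = v^{m/2}`, the
involution `u` acting by `x ↦ s x` with `s² = 1` in `ℤ/m`) and instantiates it at `m = 12` (`k = 6`), where route-2's
Theorem T sub-case (i) (INBOX L1177, ROUTE-B §9.39 / §9.36(a)) has its two degree-24 rows: `ε = −` (`u v u = c v⁻¹ =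
v⁵`, the class of `C₄ × S₃`) and `ε = +` (`u v u = c v = v⁷`, the class of `C₃ × D₄`), 12 instances per pointed
`Δ_T = {1, u, v, vu}` on the group itself.  Both are put on the kernel for EVERY finite `(G, c)` containing such `u, v`
through `c` (`exists_twistedRectQuad_k6_neg` / `_pos`), with instances on the model groups themselves; the method is
that of `TwistedQuad16.lean` (decided local conditions on the 24-element models, transport by gen 10's
`exists_quad_of_pattern`).  The witness types come from the seat's enumeration proofs/p1-g12/tswitness24.py (12 + 12
instances = route-2's count `2^{k/2+1} − 4 [k ≡ 2 mod 4]`; 0 twisted segments at `k = 6`, as route-2's (S2) predicts).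
General `k` as a theorem (rather than per-`k` decision) is not claimed.
-/

set_option autoImplicit false

open Finset Multiplicative
open scoped Pointwise

namespace HodgeRepro.TwistedQuadGen

open HodgeRepro.CosetQuad

/-! ### The model groups `ℤ/m ⋊_s ℤ/2` -/

variable (m : ℕ) [NeZero m]

/-- Multiplication by `s` on `ℤ/m` (`s² = 1`), as a multiplicative automorphism. -/
def twistAut (s : ZMod m) (hs : s * s = 1) : Multiplicative (ZMod m) ≃* Multiplicative (ZMod m) where
  toFun x := ofAdd (s * toAdd x)
  invFun x := ofAdd (s * toAdd x)
  left_inv x := by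
    show ofAdd (s * toAdd (ofAdd (s * toAdd x))) = x
    rw [toAdd_ofAdd, ← mul_assoc, hs, one_mul, ofAdd_toAdd]
  right_inv x := by
    show ofAdd (s * toAdd (ofAdd (s * toAdd x))) = x
    rw [toAdd_ofAdd, ← mul_assoc, hs, one_mul, ofAdd_toAdd]
  map_mul' x y := by
    show ofAdd (s * toAdd (x * y)) = ofAdd (s * toAdd x) * ofAdd (s * toAdd y)
    rw [toAdd_mul, mul_add, ofAdd_add]

omit [NeZero m] in
/-- `twistAut m s x = ofAdd (s · toAdd x)`. -/
theorem twistAut_apply (s : ZMod m) (hs : s * s = 1) (x : Multiplicative (ZMod m)) :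
    twistAut m s hs x = ofAdd (s * toAdd x) := rfl

omit [NeZero m] in
/-- The twist automorphism is an involution. -/
theorem twistAut_sq (s : ZMod m) (hs : s * s = 1) : twistAut m s hs ^ 2 = 1 := by
  ext x
  show twistAut m s hs (twistAut m s hs x) = x
  exact (twistAut m s hs).left_inv x

/-- The action `ℤ/2 →* Aut(ℤ/m)`, the generator acting by `twistAut m s`. -/
def twistPhi (s : ZMod m) (hs : s * s = 1) : Multiplicative (ZMod 2) →* MulAut (Multiplicative (ZMod m)) :=
  zmodPowHom 2 (twistAut m s hs) (twistAut_sq m s hs)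

omit [NeZero m] in
/-- `twistPhi` is trivial on the identity. -/
theorem twistPhi_zero (s : ZMod m) (hs : s * s = 1) : twistPhi m s hs (ofAdd 0) = 1 := by
  rw [twistPhi, zmodPowHom_apply, toAdd_ofAdd, ZMod.val_zero, pow_zero]

omit [NeZero m] in
/-- `twistPhi` sends the generator to `twistAut m s`. -/
theorem twistPhi_one (s : ZMod m) (hs : s * s = 1) : twistPhi m s hs (ofAdd 1) = twistAut m s hs := by
  rw [twistPhi, zmodPowHom_apply, toAdd_ofAdd, val_one_two, pow_one]

/-- The model group `ℤ/m ⋊_s ℤ/2`. -/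
abbrev TwistGroup (s : ZMod m) (hs : s * s = 1) : Type :=
  Multiplicative (ZMod m) ⋊[twistPhi m s hs] Multiplicative (ZMod 2)

/-- `(TwistGroup m s hs)` is a finite type (through the product of its two coordinates). -/
instance (s : ZMod m) (hs : s * s = 1) : Fintype (TwistGroup m s hs) :=
  Fintype.ofEquiv (Multiplicative (ZMod m) × Multiplicative (ZMod 2))
    { toFun := fun p => ⟨p.1, p.2⟩, invFun := fun x => (x.left, x.right),
      left_inv := fun _ => rfl, right_inv := fun _ => rfl }

/-- Equality on `(TwistGroup m s hs)` is decidable (coordinatewise). -/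
instance (s : ZMod m) (hs : s * s = 1) : DecidableEq (TwistGroup m s hs) := fun x y =>
  decidable_of_iff (x.left = y.left ∧ x.right = y.right)
    ⟨fun h => SemidirectProduct.ext h.1 h.2, fun h => ⟨congrArg _ h, congrArg _ h⟩⟩

/-- The rotation `v = (1, 0)` of the model group, of order `m`. -/
def tv (s : ZMod m) (hs : s * s = 1) : TwistGroup m s hs := SemidirectProduct.inl (ofAdd 1)

/-- The involution `u = (0, 1)` of the model group. -/
def tu (s : ZMod m) (hs : s * s = 1) : TwistGroup m s hs := SemidirectProduct.inr (ofAdd 1)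

/-- The central involution `c = v^{m/2}` of the model group. -/
def tc (s : ZMod m) (hs : s * s = 1) : TwistGroup m s hs :=
  SemidirectProduct.inl (ofAdd ((m / 2 : ℕ) : ZMod m))

/-- The twisted rectangle `{1, u, v, v u}` (route-2's `Δ_T`). -/
def rectT (s : ZMod m) (hs : s * s = 1) : Fin 4 → TwistGroup m s hs :=
  ![1, tu m s hs, tv m s hs, tv m s hs * tu m s hs]

/-! ### Transport -/

variable {G : Type*} [Group G]

/-- **Transport** (as in `TwistedQuad16.exists_quad_of_model`). -/
theorem exists_quad_of_model [Fintype G] [DecidableEq G] {s : ZMod m} {hs : s * s = 1}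
    (ψ : TwistGroup m s hs →* G) (hψ : Function.Injective ψ) {c : G} (hc : IsComplexConj c)
    (he : ψ (tc m s hs) = c) (t : Fin 4 → TwistGroup m s hs) (Φ₀ : Finset (TwistGroup m s hs))
    (h1 : ∀ p, decide (p * tc m s hs ∈ Φ₀) = !decide (p ∈ Φ₀))
    (h2 : ∀ p, (univ.filter fun i : Fin 4 => decide (p * (t i)⁻¹ ∈ Φ₀) = true).card = 2)
    (h3 : ∀ i j : Fin 4, ¬ ∀ p, (decide (p * (t j)⁻¹ ∈ Φ₀) = true ↔
      decide (p * (tc m s hs * (t i)⁻¹) ∈ Φ₀) = true)) :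
    ∃ Φ : Finset G, IsCMType c Φ ∧ SumTwo (fun i => rmul Φ (ψ (t i))) ∧
      ∀ i j : Fin 4, rmul Φ (ψ (t j)) ≠ c • rmul Φ (ψ (t i)) := by
  have hcard : Fintype.card (Fin 1) * Fintype.card (TwistGroup m s hs) ≤ Fintype.card G := by
    rw [Fintype.card_fin, one_mul]
    exact Fintype.card_le_of_injective ψ hψ
  exact exists_quad_of_pattern ψ hψ hc he t (fun (_ : Fin 1) p => decide (p ∈ Φ₀)) (fun _ p => h1 p)
    (fun _ p => h2 p) (fun i j h => h3 i j (fun p => h 0 p)) hcard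

/-- The compatibility of the power homs with the twist: `v^{s n} = u vⁿ u⁻¹`. -/
theorem twist_compat {s : ZMod m} (hs : s * s = 1) (v u : G) (hv : v ^ m = 1) (hu : u ^ 2 = 1)
    (huv : u * v * u⁻¹ = v ^ s.val) (g : Multiplicative (ZMod 2)) :
    (zmodPowHom m v hv).comp (MulEquiv.toMonoidHom (twistPhi m s hs g)) =
      (MulEquiv.toMonoidHom (MulAut.conj (zmodPowHom 2 u hu g))).comp (zmodPowHom m v hv) := by
  obtain ⟨g, rfl⟩ := ofAdd.surjective g
  refine MonoidHom.ext (fun n => ?_)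
  rw [MonoidHom.comp_apply, MonoidHom.comp_apply, MulEquiv.coe_toMonoidHom, MulEquiv.coe_toMonoidHom,
    MulAut.conj_apply]
  rcases (show ∀ x : ZMod 2, x = 0 ∨ x = 1 by decide) g with rfl | rfl
  · rw [twistPhi_zero, MulAut.one_apply, zmodPowHom_apply, zmodPowHom_apply, toAdd_ofAdd, ZMod.val_zero,
      pow_zero, one_mul, inv_one, mul_one]
  · rw [twistPhi_one, twistAut_apply, zmodPowHom_apply, zmodPowHom_apply, zmodPowHom_apply, toAdd_ofAdd,
      toAdd_ofAdd, val_one_two, pow_one, ZMod.val_mul, pow_mod_of_pow_eq_one hv, pow_mul, ← huv, conj_pow]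

/-- The hom `TwistGroup m s →* G`, `(n, g) ↦ vⁿ uᵍ`, from `v` with `vᵐ = 1` and `u` with `u² = 1`,
`u v u⁻¹ = vˢ`. -/
def modelHom {s : ZMod m} {hs : s * s = 1} (v u : G) (hv : v ^ m = 1) (hu : u ^ 2 = 1)
    (huv : u * v * u⁻¹ = v ^ s.val) : TwistGroup m s hs →* G :=
  SemidirectProduct.lift (zmodPowHom m v hv) (zmodPowHom 2 u hu) (twist_compat m hs v u hv hu huv)

/-- `modelHom` on `(n, g)`: `vⁿ uᵍ`. -/
theorem modelHom_mk {s : ZMod m} {hs : s * s = 1} (v u : G) (hv : v ^ m = 1) (hu : u ^ 2 = 1)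
    (huv : u * v * u⁻¹ = v ^ s.val) (n : Multiplicative (ZMod m)) (g : Multiplicative (ZMod 2)) :
    modelHom m (hs := hs) v u hv hu huv ⟨n, g⟩ = v ^ (toAdd n).val * u ^ (toAdd g).val := by
  rw [SemidirectProduct.mk_eq_inl_mul_inr, map_mul, modelHom, SemidirectProduct.lift_inl,
    SemidirectProduct.lift_inr, zmodPowHom_apply, zmodPowHom_apply]

/-- `modelHom v = v` (for `m ≥ 2`). -/
theorem modelHom_tv {s : ZMod m} {hs : s * s = 1} (hm : 1 < m) (v u : G) (hv : v ^ m = 1) (hu : u ^ 2 = 1)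
    (huv : u * v * u⁻¹ = v ^ s.val) : modelHom m (hs := hs) v u hv hu huv (tv m s hs) = v := by
  rw [tv, modelHom, SemidirectProduct.lift_inl, zmodPowHom_apply, toAdd_ofAdd]
  haveI : Fact (1 < m) := ⟨hm⟩
  rw [ZMod.val_one, pow_one]

/-- `modelHom u = u`. -/
theorem modelHom_tu {s : ZMod m} {hs : s * s = 1} (v u : G) (hv : v ^ m = 1) (hu : u ^ 2 = 1)
    (huv : u * v * u⁻¹ = v ^ s.val) : modelHom m (hs := hs) v u hv hu huv (tu m s hs) = u := by
  rw [tu, modelHom, SemidirectProduct.lift_inr, zmodPowHom_apply, toAdd_ofAdd, val_one_two, pow_one]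

/-- `modelHom c = v^{m/2}`. -/
theorem modelHom_tc {s : ZMod m} {hs : s * s = 1} (v u : G) (hv : v ^ m = 1) (hu : u ^ 2 = 1)
    (huv : u * v * u⁻¹ = v ^ s.val) : modelHom m (hs := hs) v u hv hu huv (tc m s hs) = v ^ (m / 2) := by
  rw [tc, modelHom, SemidirectProduct.lift_inl, zmodPowHom_apply, toAdd_ofAdd, ZMod.val_natCast,
    Nat.mod_eq_of_lt (Nat.div_lt_self (NeZero.pos m) one_lt_two)]

/-- `modelHom` is injective when `v` has order exactly `m` and `u ∉ ⟨v⟩`. -/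
theorem modelHom_injective {s : ZMod m} {hs : s * s = 1} (v u : G) (hv : v ^ m = 1) (hu : u ^ 2 = 1)
    (huv : u * v * u⁻¹ = v ^ s.val) (hvm : orderOf v = m) (hnot : u ∉ Subgroup.zpowers v) :
    Function.Injective (modelHom m (hs := hs) v u hv hu huv) := by
  rw [injective_iff_map_eq_one]
  rintro ⟨n, g⟩ hx
  rw [modelHom_mk] at hx
  obtain ⟨g, rfl⟩ := ofAdd.surjective g
  rcases (show ∀ x : ZMod 2, x = 0 ∨ x = 1 by decide) g with rfl | rfl
  · rw [toAdd_ofAdd, ZMod.val_zero, pow_zero, mul_one] at hx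
    have hm : m ∣ (toAdd n).val := by
      have hdvd := orderOf_dvd_of_pow_eq_one hx
      rwa [hvm] at hdvd
    have hn0 : (toAdd n).val = 0 := Nat.eq_zero_of_dvd_of_lt hm (ZMod.val_lt _)
    have hn : toAdd n = 0 := (ZMod.val_eq_zero _).mp hn0
    refine SemidirectProduct.ext ?_ ?_
    · show n = 1
      rw [← ofAdd_toAdd n, hn, ofAdd_zero]
    · show ofAdd (0 : ZMod 2) = 1
      exact ofAdd_zero
  · rw [toAdd_ofAdd, val_one_two, pow_one] at hx
    exfalso
    apply hnot
    rw [eq_inv_of_mul_eq_one_right hx]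
    exact Subgroup.inv_mem _ (Subgroup.npow_mem_zpowers v _)

/-- The twists of the rectangle `![1, u, v, v u]` are the images of `rectT`. -/
theorem modelHom_rectT {s : ZMod m} {hs : s * s = 1} (hm : 1 < m) (v u : G) (hv : v ^ m = 1) (hu : u ^ 2 = 1)
    (huv : u * v * u⁻¹ = v ^ s.val) (i : Fin 4) :
    modelHom m (hs := hs) v u hv hu huv (rectT m s hs i) = ![1, u, v, v * u] i := by
  fin_cases i
  · exact map_one _
  · exact modelHom_tu m v u hv hu huv
  · exact modelHom_tv m hm v u hv hu huv
  · show modelHom m (hs := hs) v u hv hu huv (tv m s hs * tu m s hs) = v * u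
    rw [map_mul, modelHom_tv m hm, modelHom_tu]

/-- **The twisted rectangle from a decided model.**  `v` of order `m > 1` with `v^{m/2} = c`, an involution
`u ∉ ⟨v⟩` with `u v u⁻¹ = vˢ`, and a subset `Φ₀` of `ℤ/m ⋊_s ℤ/2` satisfying the three decided conditions for
`Δ_T`: some CM type of `(G, c)` has `Φ, Φu, Φv, Φ(vu)` `SumTwo` without a conjugate pair. -/
theorem exists_twistedRectQuad_of_model [Fintype G] [DecidableEq G] {c : G} (hc : IsComplexConj c)
    (v u : G) {s : ZMod m} {hs : s * s = 1} (hm : 1 < m) (hvm : orderOf v = m) (hu : u ^ 2 = 1)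
    (huv : u * v * u⁻¹ = v ^ s.val) (hnot : u ∉ Subgroup.zpowers v) (hcm : v ^ (m / 2) = c)
    (Φ₀ : Finset (TwistGroup m s hs))
    (h1 : ∀ p, decide (p * tc m s hs ∈ Φ₀) = !decide (p ∈ Φ₀))
    (h2 : ∀ p, (univ.filter fun i : Fin 4 => decide (p * (rectT m s hs i)⁻¹ ∈ Φ₀) = true).card = 2)
    (h3 : ∀ i j : Fin 4, ¬ ∀ p, (decide (p * (rectT m s hs j)⁻¹ ∈ Φ₀) = true ↔
      decide (p * (tc m s hs * (rectT m s hs i)⁻¹) ∈ Φ₀) = true)) :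
    ∃ Φ : Finset G, IsCMType c Φ ∧ SumTwo (fun i => rmul Φ (![1, u, v, v * u] i)) ∧
      ∀ i j : Fin 4, rmul Φ (![1, u, v, v * u] j) ≠ c • rmul Φ (![1, u, v, v * u] i) := by
  have hv : v ^ m = 1 := by rw [← hvm]; exact pow_orderOf_eq_one v
  obtain ⟨Φ, g1, g2, g3⟩ := exists_quad_of_model m (modelHom m (hs := hs) v u hv hu huv)
    (modelHom_injective m v u hv hu huv hvm hnot) hc (by rw [modelHom_tc, hcm]) (rectT m s hs) Φ₀ h1 h2 h3
  simp only [modelHom_rectT m hm] at g2 g3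
  exact ⟨Φ, g1, g2, g3⟩

/-! ### `k = 6`: the degree-24 rows of Theorem T (i) -/

/-- `5² = 1` in `ℤ/12`. -/
theorem five_sq_twelve : (5 : ZMod 12) * 5 = 1 := by decide

/-- `7² = 1` in `ℤ/12`. -/
theorem seven_sq_twelve : (7 : ZMod 12) * 7 = 1 := by decide

/-- The model of `ε = −`, `k = 6`: `ℤ/12 ⋊ ℤ/2` with `u v u = v⁵ = c v⁻¹` (the class of `C₄ × S₃`). -/
abbrev K6neg : Type := TwistGroup 12 5 five_sq_twelve

/-- The model of `ε = +`, `k = 6`: `ℤ/12 ⋊ ℤ/2` with `u v u = v⁷ = c v` (the class of `C₃ × D₄`). -/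
abbrev K6pos : Type := TwistGroup 12 7 seven_sq_twelve

/-- A twisted-rectangle instance on `K6neg` (coordinates `(n, g) ↦ vⁿ uᵍ`). -/
def rectNeg : Finset K6neg :=
  {⟨ofAdd 0, ofAdd 0⟩, ⟨ofAdd 0, ofAdd 1⟩, ⟨ofAdd 1, ofAdd 1⟩, ⟨ofAdd 2, ofAdd 0⟩, ⟨ofAdd 2, ofAdd 1⟩,
    ⟨ofAdd 3, ofAdd 1⟩, ⟨ofAdd 4, ofAdd 1⟩, ⟨ofAdd 5, ofAdd 0⟩, ⟨ofAdd 7, ofAdd 0⟩, ⟨ofAdd 9, ofAdd 0⟩,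
    ⟨ofAdd 10, ofAdd 0⟩, ⟨ofAdd 11, ofAdd 1⟩}

/-- A twisted-rectangle instance on `K6pos`. -/
def rectPos : Finset K6pos :=
  {⟨ofAdd 0, ofAdd 0⟩, ⟨ofAdd 0, ofAdd 1⟩, ⟨ofAdd 1, ofAdd 0⟩, ⟨ofAdd 3, ofAdd 0⟩, ⟨ofAdd 5, ofAdd 0⟩,
    ⟨ofAdd 7, ofAdd 1⟩, ⟨ofAdd 8, ofAdd 0⟩, ⟨ofAdd 8, ofAdd 1⟩, ⟨ofAdd 9, ofAdd 1⟩, ⟨ofAdd 10, ofAdd 0⟩,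
    ⟨ofAdd 10, ofAdd 1⟩, ⟨ofAdd 11, ofAdd 1⟩}

/-- `(5 : ℤ/12).val = 5`. -/
theorem val_five_twelve : (5 : ZMod 12).val = 5 := by decide

/-- `(7 : ℤ/12).val = 7`. -/
theorem val_seven_twelve : (7 : ZMod 12).val = 7 := by decide

/-- **Theorem T (i), `k = 6`, `ε = −` (route-2 §9.39 / §9.36(a), the `C₄ × S₃` row; kernel existence).**  For every
finite `(G, c)`, `v` of order `12` with `v⁶ = c` and an involution `u ∉ ⟨v⟩` with `u v u⁻¹ = v⁵` (`= c v⁻¹`): some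
CM type has the twisted rectangle `Φ, Φu, Φv, Φ(vu)` `SumTwo` without a conjugate pair. -/
theorem exists_twistedRectQuad_k6_neg [Fintype G] [DecidableEq G] {c : G} (hc : IsComplexConj c) (v u : G)
    (hv12 : orderOf v = 12) (hu : u ^ 2 = 1) (huv : u * v * u⁻¹ = v ^ 5) (hnot : u ∉ Subgroup.zpowers v)
    (hc6 : v ^ 6 = c) :
    ∃ Φ : Finset G, IsCMType c Φ ∧ SumTwo (fun i => rmul Φ (![1, u, v, v * u] i)) ∧
      ∀ i j : Fin 4, rmul Φ (![1, u, v, v * u] j) ≠ c • rmul Φ (![1, u, v, v * u] i) :=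
  exists_twistedRectQuad_of_model 12 hc v u (hs := five_sq_twelve) (by norm_num) hv12 hu
    (by rw [val_five_twelve]; exact huv) hnot hc6 rectNeg (by decide) (by decide) (by decide)

/-- **Theorem T (i), `k = 6`, `ε = +` (the `C₃ × D₄` row; kernel existence).**  For every finite `(G, c)`, `v` of
order `12` with `v⁶ = c` and an involution `u ∉ ⟨v⟩` with `u v u⁻¹ = v⁷` (`= c v`): some CM type has the twisted
rectangle `Φ, Φu, Φv, Φ(vu)` `SumTwo` without a conjugate pair. -/
theorem exists_twistedRectQuad_k6_pos [Fintype G] [DecidableEq G] {c : G} (hc : IsComplexConj c) (v u : G)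
    (hv12 : orderOf v = 12) (hu : u ^ 2 = 1) (huv : u * v * u⁻¹ = v ^ 7) (hnot : u ∉ Subgroup.zpowers v)
    (hc6 : v ^ 6 = c) :
    ∃ Φ : Finset G, IsCMType c Φ ∧ SumTwo (fun i => rmul Φ (![1, u, v, v * u] i)) ∧
      ∀ i j : Fin 4, rmul Φ (![1, u, v, v * u] j) ≠ c • rmul Φ (![1, u, v, v * u] i) :=
  exists_twistedRectQuad_of_model 12 hc v u (hs := seven_sq_twelve) (by norm_num) hv12 hu
    (by rw [val_seven_twelve]; exact huv) hnot hc6 rectPos (by decide) (by decide) (by decide)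

/-- `v` has order `12` in `K6neg`. -/
theorem orderOf_tv_K6neg : orderOf (tv 12 5 five_sq_twelve) = 12 := by
  rw [orderOf_eq_iff (by norm_num)]
  exact ⟨by decide, by decide⟩

/-- `v` has order `12` in `K6pos`. -/
theorem orderOf_tv_K6pos : orderOf (tv 12 7 seven_sq_twelve) = 12 := by
  rw [orderOf_eq_iff (by norm_num)]
  exact ⟨by decide, by decide⟩

omit [NeZero m] in
/-- `u ∉ ⟨v⟩` in every model group (the right projection separates them). -/
theorem tu_not_mem_zpowers (s : ZMod m) (hs : s * s = 1) : tu m s hs ∉ Subgroup.zpowers (tv m s hs) := by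
  intro h
  obtain ⟨k, hk⟩ := Subgroup.mem_zpowers_iff.mp h
  have h' := congrArg SemidirectProduct.rightHom hk
  rw [map_zpow, tv, SemidirectProduct.rightHom_inl, one_zpow, tu, SemidirectProduct.rightHom_inr] at h'
  exact absurd h' (by decide)

/-- The twisted rectangle on the `ε = −`, `k = 6` model itself (degree 24). -/
theorem exists_twistedRectQuad_on_K6neg : ∃ Φ : Finset K6neg, IsCMType (tc 12 5 five_sq_twelve) Φ ∧
    SumTwo (fun i => rmul Φ (![1, tu 12 5 five_sq_twelve, tv 12 5 five_sq_twelve,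
      tv 12 5 five_sq_twelve * tu 12 5 five_sq_twelve] i)) ∧
    ∀ i j : Fin 4, rmul Φ (![1, tu 12 5 five_sq_twelve, tv 12 5 five_sq_twelve,
      tv 12 5 five_sq_twelve * tu 12 5 five_sq_twelve] j) ≠
      tc 12 5 five_sq_twelve • rmul Φ (![1, tu 12 5 five_sq_twelve, tv 12 5 five_sq_twelve,
        tv 12 5 five_sq_twelve * tu 12 5 five_sq_twelve] i) :=
  exists_twistedRectQuad_k6_neg ⟨by decide, by decide, by decide⟩ _ _ orderOf_tv_K6neg (by decide)
    (by decide) (tu_not_mem_zpowers _ _ _) (by decide)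

/-- The twisted rectangle on the `ε = +`, `k = 6` model itself (degree 24). -/
theorem exists_twistedRectQuad_on_K6pos : ∃ Φ : Finset K6pos, IsCMType (tc 12 7 seven_sq_twelve) Φ ∧
    SumTwo (fun i => rmul Φ (![1, tu 12 7 seven_sq_twelve, tv 12 7 seven_sq_twelve,
      tv 12 7 seven_sq_twelve * tu 12 7 seven_sq_twelve] i)) ∧
    ∀ i j : Fin 4, rmul Φ (![1, tu 12 7 seven_sq_twelve, tv 12 7 seven_sq_twelve,
      tv 12 7 seven_sq_twelve * tu 12 7 seven_sq_twelve] j) ≠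
      tc 12 7 seven_sq_twelve • rmul Φ (![1, tu 12 7 seven_sq_twelve, tv 12 7 seven_sq_twelve,
        tv 12 7 seven_sq_twelve * tu 12 7 seven_sq_twelve] i) :=
  exists_twistedRectQuad_k6_pos ⟨by decide, by decide, by decide⟩ _ _ orderOf_tv_K6pos (by decide)
    (by decide) (tu_not_mem_zpowers _ _ _) (by decide)

end HodgeRepro.TwistedQuadGen
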